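import Summits.KontsevichZagierPeriods.Zeta5Search.Certificates.VIMLevel2NKTerm
import HarnessLib

/-!
# ζ(5) search — brown9 LEVEL 2 (R-NK): closed forms at `q = N, N+1` and the kernel-checked endpoint polynomial identity (cell `pub-zeta5`, certifier `cert-1`)

HONEST FRAMING: systematic search; no irrationality claim unless certified.

Conclusion of the replay of the ttrl2 lane's R-NK certificate (`run/shared/lean/ttrl/zeta5-calc/brown9/VIM.md` §7,
`r1c/R_NK.json`): for the inner double sum `R(n,x) = Σ_{k ≤ n} h·T(n;3n−x−k,2n−k)` of the "vanishing in the middle"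
leading coefficient (fam-brown9) and every rational `x = k₃`,
  `e10(n,x)·R(n+1,x) + e00(n,x)·R(n,x) + e01(n,x)·R(n,x+1) = 0`   (`n ≥ 3`; `e.. = 5η..` of the lane),
i.e. `(n+1)³(x−2n−2)²(x−2n−1)²·R(n+1,x) + 5η₀₀·R(n,x) + 5η₀₁·R(n,x+1) = 0`.
Steps: (1) the ENDPOINT identity at `k = n` (`NK_endpoint`): the terms `s(n+1,x,n) + s(n+1,x,n+1)`, `s(n,x,n)`,
`s(n,x+1,n)` and the certificate value `g(n)` are closed forms in `C(2n−x+j, ·)` (since `T(N;p,N) = C(p,N)` and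
`T(N;p,N+1) = (N+1)C(p,N) − N·C(p−1,N)`), and their combination vanishes by a kernel-checked polynomial identity in
`(n,x)` (`endpoly`, one Kronecker evaluation; the lane's `endpoint_R.json` states the same fact); (2) summing the
termwise identity of `Certificates/VIMLevel2NKTerm.lean` over `k < n` (telescope, `g(0) = 0`) and adding the endpoint
gives the relation for `x < 0` (`R_rel_NK_neg`); (3) the left-hand side is a polynomial function of `x`
(`polyRep_*`, generic `polyRepPeval`), so it vanishes for every rational `x` (`R_rel_NK`). No named facts.
-/

noncomputable section

namespace Summit.KontsevichZagierPeriods.Zeta5Search.Certificates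

namespace VIMInner

open Finset PolyReflect Polynomial
open Lean.Grind.CommRing (Expr)

/-! ### Closed forms of `T(N;p,N)` and `T(N;p,N+1)` -/

/-- `T(N;p,N) = C(p,N)`. -/
theorem T_q_self (N : ℕ) (p : ℚ) : T N p (N : ℚ) = bp N p := by
  unfold T
  rw [sum_eq_single_of_mem 0 (mem_range.mpr (Nat.succ_pos N))]
  · simp [tT, bp_natCast]
  · intro j hj hj0
    have hjN : j ≤ N := Nat.lt_succ_iff.mp (mem_range.mp hj)
    have : ((N : ℚ) - j) = ((N - j : ℕ) : ℚ) := by push_cast [hjN]; ring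
    simp only [tT, this, bp_natCast, Nat.choose_eq_zero_of_lt (by omega : N - j < N), Nat.cast_zero, mul_zero]

/-- `T(N;p,N+1) = (N+1)·C(p,N) − N·C(p−1,N)` (`N ≥ 1`). -/
theorem T_q_succ (N : ℕ) (hN : 1 ≤ N) (p : ℚ) : T N p ((N : ℚ) + 1) = ((N : ℚ) + 1) * bp N p - (N : ℚ) * bp N (p - 1) := by
  unfold T
  have h0 : (0 : ℕ) ∈ range (N + 1) := mem_range.mpr (Nat.succ_pos N)
  have h1 : (1 : ℕ) ∈ (range (N + 1)).erase 0 := by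
    rw [mem_erase, mem_range]; exact ⟨one_ne_zero, by omega⟩
  rw [← add_sum_erase _ _ h0, ← add_sum_erase _ _ h1, sum_eq_zero]
  · have e0 : bp N ((N : ℚ) + 1) = (N : ℚ) + 1 := by
      rw [show ((N : ℚ) + 1) = ((N + 1 : ℕ) : ℚ) by push_cast; ring, bp_natCast, Nat.choose_succ_self_right]
    have e1 : bp N (N : ℚ) = 1 := by
      rw [bp_natCast, Nat.choose_self]; simp
    simp [tT, e0, e1]
    ring
  · intro j hj
    rw [mem_erase, mem_erase, mem_range] at hj
    obtain ⟨hj1, hj0, hjN⟩ := hj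
    have hjN' : j ≤ N + 1 := by omega
    have : ((N : ℚ) + 1 - j) = ((N + 1 - j : ℕ) : ℚ) := by push_cast [hjN']; ring
    simp only [tT, this, bp_natCast, Nat.choose_eq_zero_of_lt (by omega : N + 1 - j < N), Nat.cast_zero, mul_zero]

/-- `fallProd (m+3) (y+1) = (y+1)·y·fallProd m (y−1)·(y−1−m)`. -/
theorem fallProd_three_succ (m : ℕ) (y : ℚ) :
    fallProd (m + 3) (y + 1) = (y + 1) * y * fallProd m (y - 1) * (y - 1 - m) := by
  rw [show m + 3 = m + 1 + 1 + 1 from rfl, fallProd_succ_pred, fallProd_succ_pred, show y + 1 - 1 = y by ring,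
    fallProd_succ]
  ring

namespace NK

/-! ### The endpoint polynomial identity (kernel) -/

/-- Diagonal substitution `v₂ ↦ v₀` (`k₅ := n`). -/
def σdiag (i : ℕ) : Expr := if i = 2 then .var 0 else .var i

/-- `PR0(n,x,n)` is the value of the diagonal tree. -/
theorem PR0_diag (w x : ℚ) : peval (substs σdiag ePR0) [w, x, w] = PR0 w x w := by
  rw [PR0]
  exact peval_substs σdiag 3 [w, x, w] [w, x, w]
    (fun i hi => by interval_cases i <;> rfl) ePR0 ePR0_vars

/-- `PR1(n,x,n)` is the value of the diagonal tree. -/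
theorem PR1_diag (w x : ℚ) : peval (substs σdiag ePR1) [w, x, w] = PR1 w x w := by
  rw [PR1]
  exact peval_substs σdiag 3 [w, x, w] [w, x, w]
    (fun i hi => by interval_cases i <;> rfl) ePR1 ePR1_vars

/-- Endpoint cofactor of `E10`: `(-2*w + x)**3*(-2*w + x - 2)**2*(-2*w + x - 1)**2*(-w + x - 2)**2*(-w + x - 1)*(2*w**4 - w**3*x + 13*w**3 - 7*w**2*x + 30*w**2 + w*x**2 - 11*w*x + 28*w - 3*x + 8)`. -/
def eEnd_E10 : Expr :=
  (Expr.mul (Expr.add (Expr.mul (Expr.num (-2)) (Expr.var 0)) (Expr.var 1)) (Expr.mul (Expr.add (Expr.mul (Expr.num (-2)) (Expr.var 0)) (Expr.var 1)) (Expr.mul (Expr.add (Expr.mul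
  (Expr.num (-2)) (Expr.var 0)) (Expr.var 1)) (Expr.mul (Expr.add (Expr.add (Expr.mul (Expr.num (-2)) (Expr.var 0)) (Expr.var 1)) (Expr.num (-1))) (Expr.mul (Expr.add (Expr.add
  (Expr.mul (Expr.num (-2)) (Expr.var 0)) (Expr.var 1)) (Expr.num (-1))) (Expr.mul (Expr.add (Expr.add (Expr.neg (Expr.var 0)) (Expr.var 1)) (Expr.num (-2))) (Expr.mul (Expr.add
  (Expr.add (Expr.neg (Expr.var 0)) (Expr.var 1)) (Expr.num (-2))) (Expr.mul (Expr.add (Expr.add (Expr.mul (Expr.num (-2)) (Expr.var 0)) (Expr.var 1)) (Expr.num (-2))) (Expr.mul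
  (Expr.add (Expr.add (Expr.mul (Expr.num (-2)) (Expr.var 0)) (Expr.var 1)) (Expr.num (-2))) (Expr.mul (Expr.add (Expr.add (Expr.neg (Expr.var 0)) (Expr.var 1)) (Expr.num (-1)))
  ((A (A (A (M 2 4 0 0) (M (-1) 3 1 0)) (A (M 13 3 0 0) (A (M (-7) 2 1 0) (M 30 2 0 0)))) (A (A (M 1 1 2 0) (M (-11) 1 1 0)) (A (M 28 1 0 0) (A (M (-3) 0 1 0) (M 8 0 0
  0))))))))))))))))

/-- `eEnd_E10` in ordinary form at the diagonal point. -/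
theorem bEnd_E10 (n : ℕ) (x : ℚ) : peval eEnd_E10 [(n : ℚ), x, (n : ℚ)] = (-2*(n : ℚ) + x)^3*(-2*(n : ℚ) + x - 2)^2*(-2*(n : ℚ) + x - 1)^2*(-(n : ℚ) + x - 2)^2*(-(n : ℚ) + x - 1)*(2*(n : ℚ)^4 - (n : ℚ)^3*x + 13*(n : ℚ)^3 - 7*(n : ℚ)^2*x + 30*(n : ℚ)^2 + (n : ℚ)*x^2 - 11*(n : ℚ)*x + 28*(n : ℚ) - 3*x + 8) := by
  have d0 : pvar [(n : ℚ), x, (n : ℚ)] 0 = (n : ℚ) := rfl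
  have d1 : pvar [(n : ℚ), x, (n : ℚ)] 1 = x := rfl
  have d2 : pvar [(n : ℚ), x, (n : ℚ)] 2 = (n : ℚ) := rfl
  simp only [eEnd_E10, peval_mul, peval_add, peval_neg, peval_num, A, peval_M, peval_var, d0, d1, d2]
  push_cast
  ring

/-- Endpoint cofactor of `E00`: `(-2*w + x)**3*(w + 1)**2*(-w + x - 2)**4*(-w + x - 1)**3`. -/
def eEnd_E00 : Expr :=
  (Expr.mul (Expr.add (Expr.var 0) (Expr.num 1)) (Expr.mul (Expr.add (Expr.var 0) (Expr.num 1)) (Expr.mul (Expr.add (Expr.mul (Expr.num (-2)) (Expr.var 0)) (Expr.var 1)) (Expr.mul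
  (Expr.add (Expr.mul (Expr.num (-2)) (Expr.var 0)) (Expr.var 1)) (Expr.mul (Expr.add (Expr.mul (Expr.num (-2)) (Expr.var 0)) (Expr.var 1)) (Expr.mul (Expr.add (Expr.add (Expr.neg
  (Expr.var 0)) (Expr.var 1)) (Expr.num (-1))) (Expr.mul (Expr.add (Expr.add (Expr.neg (Expr.var 0)) (Expr.var 1)) (Expr.num (-1))) (Expr.mul (Expr.add (Expr.add (Expr.neg
  (Expr.var 0)) (Expr.var 1)) (Expr.num (-1))) (Expr.mul (Expr.add (Expr.add (Expr.neg (Expr.var 0)) (Expr.var 1)) (Expr.num (-2))) (Expr.mul (Expr.add (Expr.add (Expr.neg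
  (Expr.var 0)) (Expr.var 1)) (Expr.num (-2))) (Expr.mul (Expr.add (Expr.add (Expr.neg (Expr.var 0)) (Expr.var 1)) (Expr.num (-2))) (Expr.add (Expr.add (Expr.neg (Expr.var 0))
  (Expr.var 1)) (Expr.num (-2))))))))))))))

/-- `eEnd_E00` in ordinary form at the diagonal point. -/
theorem bEnd_E00 (n : ℕ) (x : ℚ) : peval eEnd_E00 [(n : ℚ), x, (n : ℚ)] = (-2*(n : ℚ) + x)^3*((n : ℚ) + 1)^2*(-(n : ℚ) + x - 2)^4*(-(n : ℚ) + x - 1)^3 := by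
  have d0 : pvar [(n : ℚ), x, (n : ℚ)] 0 = (n : ℚ) := rfl
  have d1 : pvar [(n : ℚ), x, (n : ℚ)] 1 = x := rfl
  simp only [eEnd_E00, peval_mul, peval_add, peval_neg, peval_num, peval_var, d0, d1]
  push_cast
  ring

/-- Endpoint cofactor of `E01`: `(-2*w + x)*(-w + x)**2*(w + 1)**2*(-w + x - 2)**4*(-w + x - 1)**3`. -/
def eEnd_E01 : Expr :=
  (Expr.mul (Expr.add (Expr.var 0) (Expr.num 1)) (Expr.mul (Expr.add (Expr.var 0) (Expr.num 1)) (Expr.mul (Expr.add (Expr.neg (Expr.var 0)) (Expr.var 1)) (Expr.mul (Expr.add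
  (Expr.neg (Expr.var 0)) (Expr.var 1)) (Expr.mul (Expr.add (Expr.mul (Expr.num (-2)) (Expr.var 0)) (Expr.var 1)) (Expr.mul (Expr.add (Expr.add (Expr.neg (Expr.var 0)) (Expr.var
  1)) (Expr.num (-1))) (Expr.mul (Expr.add (Expr.add (Expr.neg (Expr.var 0)) (Expr.var 1)) (Expr.num (-1))) (Expr.mul (Expr.add (Expr.add (Expr.neg (Expr.var 0)) (Expr.var 1))
  (Expr.num (-1))) (Expr.mul (Expr.add (Expr.add (Expr.neg (Expr.var 0)) (Expr.var 1)) (Expr.num (-2))) (Expr.mul (Expr.add (Expr.add (Expr.neg (Expr.var 0)) (Expr.var 1))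
  (Expr.num (-2))) (Expr.mul (Expr.add (Expr.add (Expr.neg (Expr.var 0)) (Expr.var 1)) (Expr.num (-2))) (Expr.add (Expr.add (Expr.neg (Expr.var 0)) (Expr.var 1)) (Expr.num
  (-2))))))))))))))

/-- `eEnd_E01` in ordinary form at the diagonal point. -/
theorem bEnd_E01 (n : ℕ) (x : ℚ) : peval eEnd_E01 [(n : ℚ), x, (n : ℚ)] = (-2*(n : ℚ) + x)*(-(n : ℚ) + x)^2*((n : ℚ) + 1)^2*(-(n : ℚ) + x - 2)^4*(-(n : ℚ) + x - 1)^3 := by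
  have d0 : pvar [(n : ℚ), x, (n : ℚ)] 0 = (n : ℚ) := rfl
  have d1 : pvar [(n : ℚ), x, (n : ℚ)] 1 = x := rfl
  simp only [eEnd_E01, peval_mul, peval_add, peval_neg, peval_num, peval_var, d0, d1]
  push_cast
  ring

/-- Endpoint cofactor of `P0`: `w*(-2*w + x)**2*(w + 1)**2*(-w + x - 2)**2*(-w + x - 1)**2`. -/
def eEnd_P0 : Expr :=
  (Expr.mul (Expr.var 0) (Expr.mul (Expr.add (Expr.var 0) (Expr.num 1)) (Expr.mul (Expr.add (Expr.var 0) (Expr.num 1)) (Expr.mul (Expr.add (Expr.mul (Expr.num (-2)) (Expr.var 0))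
  (Expr.var 1)) (Expr.mul (Expr.add (Expr.mul (Expr.num (-2)) (Expr.var 0)) (Expr.var 1)) (Expr.mul (Expr.add (Expr.add (Expr.neg (Expr.var 0)) (Expr.var 1)) (Expr.num (-1)))
  (Expr.mul (Expr.add (Expr.add (Expr.neg (Expr.var 0)) (Expr.var 1)) (Expr.num (-1))) (Expr.mul (Expr.add (Expr.add (Expr.neg (Expr.var 0)) (Expr.var 1)) (Expr.num (-2)))
  (Expr.add (Expr.add (Expr.neg (Expr.var 0)) (Expr.var 1)) (Expr.num (-2)))))))))))

/-- `eEnd_P0` in ordinary form at the diagonal point. -/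
theorem bEnd_P0 (n : ℕ) (x : ℚ) : peval eEnd_P0 [(n : ℚ), x, (n : ℚ)] = (n : ℚ)*(-2*(n : ℚ) + x)^2*((n : ℚ) + 1)^2*(-(n : ℚ) + x - 2)^2*(-(n : ℚ) + x - 1)^2 := by
  have d0 : pvar [(n : ℚ), x, (n : ℚ)] 0 = (n : ℚ) := rfl
  have d1 : pvar [(n : ℚ), x, (n : ℚ)] 1 = x := rfl
  simp only [eEnd_P0, peval_mul, peval_add, peval_neg, peval_num, peval_var, d0, d1]
  push_cast
  ring

/-- Endpoint cofactor of `P1`: `w*(-2*w + x)**2*(w + 1)**2*(-2*w + x - 1)*(-w + x - 2)**2*(-w + x - 1)`. -/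
def eEnd_P1 : Expr :=
  (Expr.mul (Expr.var 0) (Expr.mul (Expr.add (Expr.var 0) (Expr.num 1)) (Expr.mul (Expr.add (Expr.var 0) (Expr.num 1)) (Expr.mul (Expr.add (Expr.mul (Expr.num (-2)) (Expr.var 0))
  (Expr.var 1)) (Expr.mul (Expr.add (Expr.mul (Expr.num (-2)) (Expr.var 0)) (Expr.var 1)) (Expr.mul (Expr.add (Expr.add (Expr.neg (Expr.var 0)) (Expr.var 1)) (Expr.num (-2)))
  (Expr.mul (Expr.add (Expr.add (Expr.neg (Expr.var 0)) (Expr.var 1)) (Expr.num (-2))) (Expr.mul (Expr.add (Expr.add (Expr.neg (Expr.var 0)) (Expr.var 1)) (Expr.num (-1)))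
  (Expr.add (Expr.add (Expr.mul (Expr.num (-2)) (Expr.var 0)) (Expr.var 1)) (Expr.num (-1)))))))))))

/-- `eEnd_P1` in ordinary form at the diagonal point. -/
theorem bEnd_P1 (n : ℕ) (x : ℚ) : peval eEnd_P1 [(n : ℚ), x, (n : ℚ)] = (n : ℚ)*(-2*(n : ℚ) + x)^2*((n : ℚ) + 1)^2*(-2*(n : ℚ) + x - 1)*(-(n : ℚ) + x - 2)^2*(-(n : ℚ) + x - 1) := by
  have d0 : pvar [(n : ℚ), x, (n : ℚ)] 0 = (n : ℚ) := rfl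
  have d1 : pvar [(n : ℚ), x, (n : ℚ)] 1 = x := rfl
  simp only [eEnd_P1, peval_mul, peval_add, peval_neg, peval_num, peval_var, d0, d1]
  push_cast
  ring

/-- The reflected endpoint combination. -/
def eEnd : Expr :=
  (Expr.add (Expr.add (Expr.add (Expr.add (Expr.mul eEnd_E10 eE10) (Expr.mul eEnd_E00 eE00)) (Expr.mul eEnd_E01
  eE01)) (Expr.mul eEnd_P0 (substs σdiag ePR0))) (Expr.mul eEnd_P1 (substs σdiag ePR1)))

/-- **Endpoint polynomial identity** (kernel, one Kronecker evaluation): with `w = n`,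
`Σ_s cofEnd_s(n,x)·DATA_s(n,x,n) = 0`. -/
theorem endpoly (w x : ℚ) :
    peval eEnd_E10 [w, x, w] * e10 w x + peval eEnd_E00 [w, x, w] * e00 w x + peval eEnd_E01 [w, x, w] * e01 w x
      + peval eEnd_P0 [w, x, w] * PR0 w x w + peval eEnd_P1 [w, x, w] * PR1 w x w = 0 := by
  have h := peval_eq_zero_of_kron eEnd (by decide +kernel) (by decide +kernel) w x w
  simp only [eEnd, peval_add, peval_mul, e10_peval, e00_peval, e01_peval, PR0_diag, PR1_diag] at h
  exact h

end NK

end VIMInner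

end Summit.KontsevichZagierPeriods.Zeta5Search.Certificates
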